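/-
COR-CM (cell pub-hodgecm2, stage 2 of the Hodge ladder) — count-neutral own lane FOREIGN-SURFACE, part 3 (seat prover-pub-hodgecm2-p2,
binder prover 2, gen 23).  Theorems only; no definition, no named fact, nothing asserted.  Composition BY NAME of part 1
(`CorCM/FacePeriodsForeignSurface.lean`, p302314) with the tree's quadruple-level symmetries of `PeriodNV` — b07's `FaceSquareSymmetry` /
`FacePeriodDuality` (swap, antipode, dual: `periodNV_comp_swap23_iff`, `periodNV_comp_swap01_swap23_iff`, `periodNV_comp_swapPairs_iff`, all
typed with a FOREIGN surface) and b06 / b01-idea-1's Galois twist `Model.periodNV_twist` (`CMTwistSemilinear`, foreign surface) — and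
b07's eigencharacter transport `Model.periodNV_of_periodNV_of_forall_mem`; nothing of theirs is restated except that the three face-level
square wrappers are re-derived with the surface field freed (b07's face-level wrappers pin `V : HermSpace3 F ι₁`).  NOT an E term, NOT a display
of record, no BINDER-OWNERS row; `Interfaces.lean` (C1) and `Assembly/ModelChain*.lean` untouched.

HONEST FRAMING (COORDINATOR RULING — HODGE FRAMING CORRECTION, 2026-08-21T11:55:35Z): `HC_CM` is NOT proved, here or anywhere in the tree.
This file proves NO face period.  It records the ORBIT NORMAL FORM of the residue of binder B01 with foreign surfaces: `HC_CM` follows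
from ONE foreign period datum per class of faces under the Galois twists `g · f` (`g ∈ Aut F`) and the eight symmetries of the type square,
for every Galois CM field `F` of degree `≥ 6`.
-/
import Summits.HodgeConjecture.CorCM.FacePeriodsForeignSurface
import Summits.HodgeConjecture.CorCM.FacePeriodOrbit
import HarnessLib

/-!
# One foreign face period per (Galois twist × type square)-class of faces ⟹ `HC_CM`

Part 1 closed the chain from FOREIGN face-period witnesses: `hc_cm_closed_of_exists_foreignFacePeriod` — for every Galois CM field `F`
with `6 ≤ [F:ℚ]` and EVERY rank-four face `f` of `F`, one datum `(L, ι₁, V, σ, Γ, …)` with `L` ANY CM field.  The tree already knows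
that `PeriodNV` is transported along the symmetries of the face datum on the SAME surface, and those transports were typed by their
authors over an arbitrary surface field `L`:

* Galois twist (b01-idea-1 / b06, `Model.periodNV_twist`, `CMTwistSemilinear.lean` :308): `PeriodNV ι₁ V F Ψ σ → PeriodNV ι₁ V F Ψ^g (σ ∘ g⁻¹)`
  for `g ∈ Aut F`, provided `σ` lies in all four types;
* eigencharacter transport (b07, `Model.periodNV_of_periodNV_of_forall_mem`, `PeriodCharacterTransport.lean` :352): `σ ↦ τ` for any `τ`
  in all four types;
* the square (b07, `FaceSquareSymmetry.lean` :221/:238, `FacePeriodDuality.lean` :231): `Ψ ↦ Ψ ∘ (2 3)`, `Ψ ∘ (0 1)(2 3)`, `Ψ ∘ (0 2)(1 3)`.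

Hence (this file):

* §1 `Universe.periodNV_foreign_iff_of_sameSquare` — b07's «`PeriodNV` depends only on the square» with the surface field freed
  (the face-level wrappers `periodNV_foreign_face_swap_iff` / `…antipode…` / `…dual…`);
* §2 `Model.exists_foreignPeriodNV_face_twist` — on the universe of record, a foreign witness for `f` gives a foreign witness for every
  twisted face `f.twist g` on the SAME foreign surface (pick an admissible `ι₀` of `f` by `StubTree.admissible_exists`, move `σ ↦ ι₀`,
  twist); `Model.exists_foreignPeriodNV_of_sameSquare_twist` — and for every face in the square of a twist;
* §3 **`hc_cm_closed_of_exists_foreignFacePeriod_upToTwist`** and **`hc_cm_closed_of_foreignFacePeriod_representatives`** — `HC_CM`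
  from ONE foreign period datum per (twist × square)-class of faces of every Galois CM field of degree `≥ 6`; §4 the field-local form.

Counting (hodge-director/B01-SIZE.md §5 (β), FacePeriodOrbit.lean header): a Galois CM field of degree `2g` has `2^g·g(g−1)/2` faces (`24` at
`g = 3`, `96` at `g = 4`), `|Aut F| = 2g`, and eight faces per square; at degree `6` with `Gal ≅ C₆` ONE class per field.  So the residue of
binder B01 in the kernel now reads: **∀ F Galois CM of degree ≥ 6 × ONE face per (Aut F × square)-class × ONE datum `(L, ι₁, V, Γ, σ, (F_i), (α_i))`
with `L` any CM field** — (Δ1) × (Δ2 modulo symmetry), Δ3 Δ4 Δ5 gone.  Nothing here asserts any period; `HC_CM` is NOT proved.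

## References
* rfwf v3 (2001 programme) Prop. 2.2 / Thm 1.3 / Lemma 8.2; [Pohlmann1968] Thm. 1; [Andre1992HodgeCM] Théorème pp. 4–5;
  [Milne2020HodgeClassesAV] Theorem 1; [Shimura1998] §6.2 Thm 3, §14 (twists of CM types by automorphisms); [DeligneMilne1982Tannakian] Thm. 6.20.
-/

noncomputable section

open CategoryTheory NumberField
open Literature.AlgebraicGeometry Literature.AlgebraicGeometry.Motives Literature.AlgebraicGeometry.HodgeTheory
open Literature.AlgebraicGeometry.ComplexMultiplication Literature.AlgebraicGeometry.Milne1999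
open Literature.NumberTheory.ComplexMultiplication.CMTypeOps
open Literature.NumberTheory.Automorphic
open Literature.NumberTheory.Automorphic.PicardCM

namespace Summit.HodgeConjecture.CorCM

/-! ## §1 The type square with a foreign surface (abstract universe) -/

namespace Universe

variable {U : Universe}

/-- `PeriodNV` on a FOREIGN surface is unchanged by swapping the two places of the face (b07's `periodNV_face_swap_iff`, surface field
freed). [folklore] -/
theorem periodNV_foreign_face_swap_iff (h1 : U.Fact_cup_comm1) {F : CMField} (f : Face F) {L : CMField} {ι₁ : L →+* ℂ}
    (V : HermSpace3 L ι₁) (σ : F →+* ℂ) : U.PeriodNV ι₁ V F f.swap.psi σ ↔ U.PeriodNV ι₁ V F f.psi σ := by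
  rw [Face.swap_psi_eq_comp]
  exact periodNV_comp_swap23_iff h1 F f.psi σ

/-- `PeriodNV` on a FOREIGN surface is unchanged by moving the base corner to the antipodal corner (b07's `periodNV_face_antipode_iff`,
surface field freed). [folklore] -/
theorem periodNV_foreign_face_antipode_iff (h1 : U.Fact_cup_comm1) {F : CMField} (f : Face F) {L : CMField} {ι₁ : L →+* ℂ}
    (V : HermSpace3 L ι₁) (σ : F →+* ℂ) : U.PeriodNV ι₁ V F f.antipode.psi σ ↔ U.PeriodNV ι₁ V F f.psi σ := by
  rw [Face.antipode_psi_eq_comp]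
  exact periodNV_comp_swap01_swap23_iff h1 F f.psi σ

/-- `PeriodNV` on a FOREIGN surface is unchanged by passing to the dual face (b07's `periodNV_face_dual_iff`, surface field freed).
[folklore] -/
theorem periodNV_foreign_face_dual_iff (h1 : U.Fact_cup_comm1) (h2 : U.Fact_cup_interchange) {F : CMField} (f : Face F)
    {L : CMField} {ι₁ : L →+* ℂ} (V : HermSpace3 L ι₁) (σ : F →+* ℂ) :
    U.PeriodNV ι₁ V F f.dual.psi σ ↔ U.PeriodNV ι₁ V F f.psi σ := by
  rw [Face.dual_psi_eq_comp]
  exact periodNV_comp_swapPairs_iff h1 h2 F f.psi σ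

/-- **`PeriodNV` on a FOREIGN surface depends only on the type square of the face** (b07's `periodNV_iff_of_sameSquare`, proof verbatim,
surface field freed): if `f'` has the same unordered pair of places as `f` and its base type is one of the four corners of the square of `f`,
the period statements for `f'` and `f` — on the same Picard modular surface over ANY CM field `L`, same `ι₁`, same `V`, same `σ` — are
equivalent. [folklore] -/
theorem periodNV_foreign_iff_of_sameSquare (h1 : U.Fact_cup_comm1) (h2 : U.Fact_cup_interchange) {F : CMField} {f f' : Face F}
    (hpl : (InfinitePlace.mk f'.p = InfinitePlace.mk f.p ∧ InfinitePlace.mk f'.p' = InfinitePlace.mk f.p') ∨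
      (InfinitePlace.mk f'.p = InfinitePlace.mk f.p' ∧ InfinitePlace.mk f'.p' = InfinitePlace.mk f.p))
    (hΦ : f'.Φ = f.Φ ∨ f'.Φ = flip f.p f.Φ ∨ f'.Φ = flip f.p' f.Φ ∨ f'.Φ = flip f.p' (flip f.p f.Φ))
    {L : CMField} {ι₁ : L →+* ℂ} (V : HermSpace3 L ι₁) (σ : F →+* ℂ) :
    U.PeriodNV ι₁ V F f'.psi σ ↔ U.PeriodNV ι₁ V F f.psi σ := by
  rcases hpl with ⟨hp, hp'⟩ | ⟨hp, hp'⟩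
  · rcases hΦ with hΦ | hΦ | hΦ | hΦ
    · rw [Face.psi_eq_of_mk_eq (f := f) hΦ hp hp']
    · rw [Face.psi_eq_of_mk_eq (f := f.dual) hΦ hp hp']
      exact periodNV_foreign_face_dual_iff h1 h2 f V σ
    · rw [Face.psi_eq_of_mk_eq (f := f.swap.dual.swap) hΦ hp hp', periodNV_foreign_face_swap_iff h1,
        periodNV_foreign_face_dual_iff h1 h2, periodNV_foreign_face_swap_iff h1]
    · rw [Face.psi_eq_of_mk_eq (f := f.antipode) hΦ hp hp']
      exact periodNV_foreign_face_antipode_iff h1 f V σ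
  · rcases hΦ with hΦ | hΦ | hΦ | hΦ
    · rw [Face.psi_eq_of_mk_eq (f := f.swap) hΦ hp hp']
      exact periodNV_foreign_face_swap_iff h1 f V σ
    · rw [Face.psi_eq_of_mk_eq (f := f.dual.swap) hΦ hp hp', periodNV_foreign_face_swap_iff h1]
      exact periodNV_foreign_face_dual_iff h1 h2 f V σ
    · rw [Face.psi_eq_of_mk_eq (f := f.swap.dual) hΦ hp hp', periodNV_foreign_face_dual_iff h1 h2,
        periodNV_foreign_face_swap_iff h1]
    · have hΦ' : f'.Φ = f.antipode.swap.Φ := by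
        rw [hΦ]; rfl
      rw [Face.psi_eq_of_mk_eq (f := f.antipode.swap) hΦ' hp hp', periodNV_foreign_face_swap_iff h1]
      exact periodNV_foreign_face_antipode_iff h1 f V σ

end Universe

/-! ## §2 Twists and squares on the universe of record, foreign surface -/

namespace Model

/-- **A foreign witness for `f` gives a foreign witness for every Galois twist `g · f`, on the SAME foreign surface** (universe of record
`picardCMUniverse hHD hI h₁ h₃`; `[F:ℚ] ≥ 6` only to pick an admissible place `ι₀` of `f`, `StubTree.admissible_exists`): move the
eigencharacter `σ ↦ ι₀` (`periodNV_of_periodNV_of_forall_mem`, `admissible_mem_psi`), then twist (`periodNV_twist`, `Face.twist_psi`);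
the new eigencharacter is `ι₀ ∘ g⁻¹`. [cite: Shimura1998, §6.2 Theorem 3 (pp. 41–43)] -/
theorem exists_foreignPeriodNV_face_twist (hHD : exists_isReal_hodgeModel) (hI : hodgePQ_independent_of_hodgeModel)
    (h₁ : BallQuotientUniformised) (h₃ : CMAbelianVarietyRealised) {F : CMField} (h6 : 6 ≤ Module.finrank ℚ F) (f : Face F)
    (g : F ≃+* F) {L : CMField} {ι₁ : L →+* ℂ} {V : HermSpace3 L ι₁} {σ : F →+* ℂ}
    (h : (picardCMUniverse hHD hI h₁ h₃).PeriodNV ι₁ V F f.psi σ) :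
    ∃ τ : F →+* ℂ, (picardCMUniverse hHD hI h₁ h₃).PeriodNV ι₁ V F (f.twist g).psi τ := by
  obtain ⟨ι₀, hι₀⟩ := StubTree.admissible_exists F h6 f
  have hmem := admissible_mem_psi f ι₀ hι₀
  have h' := periodNV_twist hHD hI h₁ h₃ g hmem (periodNV_of_periodNV_of_forall_mem hHD hI h₁ h₃ V f.psi hmem h)
  refine ⟨ι₀.comp g.symm.toRingHom, ?_⟩
  rw [funext (Face.twist_psi g f)]
  exact h'

/-- **… and for every face in the type square of a twist**: if `f'` lies in the square of `f.twist g` (same unordered places, base type a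
corner), a foreign witness for `f` gives one for `f'` on the same foreign surface (§1 on rows M19/M20 `cup_comm1`/`cup_interchange` of
`picardCMUniverse_modelAxioms`). [cite: Shimura1998, §6.2 Theorem 3 (pp. 41–43)] -/
theorem exists_foreignPeriodNV_of_sameSquare_twist (hHD : exists_isReal_hodgeModel) (hI : hodgePQ_independent_of_hodgeModel)
    (h₁ : BallQuotientUniformised) (h₃ : CMAbelianVarietyRealised) {F : CMField} (h6 : 6 ≤ Module.finrank ℚ F) (f : Face F)
    (g : F ≃+* F) {f' : Face F}
    (hpl : (InfinitePlace.mk f'.p = InfinitePlace.mk (f.twist g).p ∧ InfinitePlace.mk f'.p' = InfinitePlace.mk (f.twist g).p') ∨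
      (InfinitePlace.mk f'.p = InfinitePlace.mk (f.twist g).p' ∧ InfinitePlace.mk f'.p' = InfinitePlace.mk (f.twist g).p))
    (hΦ : f'.Φ = (f.twist g).Φ ∨ f'.Φ = flip (f.twist g).p (f.twist g).Φ ∨ f'.Φ = flip (f.twist g).p' (f.twist g).Φ ∨
      f'.Φ = flip (f.twist g).p' (flip (f.twist g).p (f.twist g).Φ))
    {L : CMField} {ι₁ : L →+* ℂ} {V : HermSpace3 L ι₁} {σ : F →+* ℂ}
    (h : (picardCMUniverse hHD hI h₁ h₃).PeriodNV ι₁ V F f.psi σ) :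
    ∃ τ : F →+* ℂ, (picardCMUniverse hHD hI h₁ h₃).PeriodNV ι₁ V F f'.psi τ := by
  obtain ⟨τ, hτ⟩ := exists_foreignPeriodNV_face_twist hHD hI h₁ h₃ h6 f g h
  exact ⟨τ, (Universe.periodNV_foreign_iff_of_sameSquare (picardCMUniverse_modelAxioms hHD hI h₁ h₃).cup_comm1
    (picardCMUniverse_modelAxioms hHD hI h₁ h₃).cup_interchange hpl hΦ V τ).2 hτ⟩

end Model

/-! ## §3 CLOSED: `HC_CM` from one foreign datum per (twist × square)-class of faces -/

/-- **`HC_CM` from foreign face periods UP TO GALOIS TWIST.**  On the universe of record: if for every Galois CM field `F` with `6 ≤ [F:ℚ]`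
every rank-four face of `F` is a Galois twist `f₀.twist g` (`g ∈ Aut F`) of a face `f₀` carrying ONE non-zero period on a compact Picard
modular surface of SOME CM field at SOME place (the foreign witness of part 1), then the Hodge conjecture holds for every complex abelian
variety of CM type.  FRAMING: conditional; `HC_CM` is NOT proved. [cite: Pohlmann1968, Thm. 1] [cite: Andre1992HodgeCM, Théorème (pp. 4–5)]
[cite: Milne2020HodgeClassesAV, Theorem 1] [cite: Shimura1998, §6.2 Theorem 3 (pp. 41–43)] -/
theorem hc_cm_closed_of_exists_foreignFacePeriod_upToTwist
    (h : ∀ (F : CMField), IsGalois ℚ F → 6 ≤ Module.finrank ℚ F → ∀ f : Face F,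
      ∃ (f₀ : Face F) (g : (F : Type) ≃+* F), f₀.twist g = f ∧
        ∃ (L : CMField) (ι₁ : L →+* ℂ) (V : HermSpace3 L ι₁) (σ : F →+* ℂ),
          (Model.picardCMUniverse exists_isReal_hodgeModel_holds hodgePQ_independent_of_hodgeModel_holds
            BallQuotient.ballQuotientUniformised_holds cmAbelianVarietyRealised_holds).PeriodNV ι₁ V F f₀.psi σ) : HC_CM := by
  refine hc_cm_closed_of_exists_foreignFacePeriod fun F hG h6 f => ?_
  obtain ⟨f₀, g, rfl, L, ι₁, V, σ, hw⟩ := h F hG h6 f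
  obtain ⟨τ, hτ⟩ := Model.exists_foreignPeriodNV_face_twist _ _ _ _ h6 f₀ g hw
  exact ⟨L, ι₁, V, τ, hτ⟩

/-- **`HC_CM` from foreign face periods UP TO TWIST AND SQUARE.**  As above, but each face `f` of `F` need only lie in the TYPE SQUARE
(same unordered pair of places, base type one of the four corners) of a twist `f₀.twist g` of a witnessed face `f₀`. FRAMING: conditional;
`HC_CM` is NOT proved. [cite: Pohlmann1968, Thm. 1] [cite: Andre1992HodgeCM, Théorème (pp. 4–5)] [cite: Milne2020HodgeClassesAV, Theorem 1] -/
theorem hc_cm_closed_of_exists_foreignFacePeriod_upToTwistAndSquare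
    (h : ∀ (F : CMField), IsGalois ℚ F → 6 ≤ Module.finrank ℚ F → ∀ f : Face F,
      ∃ (f₀ : Face F) (g : (F : Type) ≃+* F),
        ((InfinitePlace.mk f.p = InfinitePlace.mk (f₀.twist g).p ∧ InfinitePlace.mk f.p' = InfinitePlace.mk (f₀.twist g).p') ∨
          (InfinitePlace.mk f.p = InfinitePlace.mk (f₀.twist g).p' ∧ InfinitePlace.mk f.p' = InfinitePlace.mk (f₀.twist g).p)) ∧
        (f.Φ = (f₀.twist g).Φ ∨ f.Φ = flip (f₀.twist g).p (f₀.twist g).Φ ∨ f.Φ = flip (f₀.twist g).p' (f₀.twist g).Φ ∨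
          f.Φ = flip (f₀.twist g).p' (flip (f₀.twist g).p (f₀.twist g).Φ)) ∧
        ∃ (L : CMField) (ι₁ : L →+* ℂ) (V : HermSpace3 L ι₁) (σ : F →+* ℂ),
          (Model.picardCMUniverse exists_isReal_hodgeModel_holds hodgePQ_independent_of_hodgeModel_holds
            BallQuotient.ballQuotientUniformised_holds cmAbelianVarietyRealised_holds).PeriodNV ι₁ V F f₀.psi σ) : HC_CM := by
  refine hc_cm_closed_of_exists_foreignFacePeriod fun F hG h6 f => ?_
  obtain ⟨f₀, g, hpl, hΦ, L, ι₁, V, σ, hw⟩ := h F hG h6 f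
  obtain ⟨τ, hτ⟩ := Model.exists_foreignPeriodNV_of_sameSquare_twist _ _ _ _ h6 f₀ g hpl hΦ hw
  exact ⟨L, ι₁, V, τ, hτ⟩

/-- **REPRESENTATIVES FORM — the residue of binder B01 in orbit normal form.**  Let `R` select faces («representatives») such that every
face `f` of every Galois CM field `F` of degree `≥ 6` lies in the type square of a Galois twist of some selected face.  If every SELECTED
face has ONE non-zero period on a compact Picard modular surface of SOME CM field at SOME place (foreign witness on the universe of record),
then `HC_CM`.  (At degree `6`, `Gal(F/ℚ) ≅ C₆`: one selected face per field suffices — `FacePeriodOrbit.lean`, `FaceSquareSymmetry.lean`.)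
FRAMING: conditional; no period is produced here; `HC_CM` is NOT proved. [cite: Pohlmann1968, Thm. 1] [cite: Andre1992HodgeCM, Théorème (pp. 4–5)]
[cite: Milne2020HodgeClassesAV, Theorem 1] [cite: Shimura1998, §6.2 Theorem 3 (pp. 41–43)] -/
theorem hc_cm_closed_of_foreignFacePeriod_representatives (R : ∀ ⦃F : CMField⦄, Face F → Prop)
    (hR : ∀ (F : CMField), IsGalois ℚ F → 6 ≤ Module.finrank ℚ F → ∀ f : Face F,
      ∃ (f₀ : Face F) (g : (F : Type) ≃+* F), R f₀ ∧
        ((InfinitePlace.mk f.p = InfinitePlace.mk (f₀.twist g).p ∧ InfinitePlace.mk f.p' = InfinitePlace.mk (f₀.twist g).p') ∨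
          (InfinitePlace.mk f.p = InfinitePlace.mk (f₀.twist g).p' ∧ InfinitePlace.mk f.p' = InfinitePlace.mk (f₀.twist g).p)) ∧
        (f.Φ = (f₀.twist g).Φ ∨ f.Φ = flip (f₀.twist g).p (f₀.twist g).Φ ∨ f.Φ = flip (f₀.twist g).p' (f₀.twist g).Φ ∨
          f.Φ = flip (f₀.twist g).p' (flip (f₀.twist g).p (f₀.twist g).Φ)))
    (h : ∀ (F : CMField), IsGalois ℚ F → 6 ≤ Module.finrank ℚ F → ∀ f : Face F, R f →
      ∃ (L : CMField) (ι₁ : L →+* ℂ) (V : HermSpace3 L ι₁) (σ : F →+* ℂ),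
        (Model.picardCMUniverse exists_isReal_hodgeModel_holds hodgePQ_independent_of_hodgeModel_holds
          BallQuotient.ballQuotientUniformised_holds cmAbelianVarietyRealised_holds).PeriodNV ι₁ V F f.psi σ) : HC_CM := by
  refine hc_cm_closed_of_exists_foreignFacePeriod_upToTwistAndSquare fun F hG h6 f => ?_
  obtain ⟨f₀, g, hR₀, hpl, hΦ⟩ := hR F hG h6 f
  exact ⟨f₀, g, hpl, hΦ, h F hG h6 f₀ hR₀⟩

/-! ## §4 Field-local form: one Galois CM field, foreign witnesses up to twist and square -/

open Summit.HodgeConjecture.CorCM.Domination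

/-- **The `K`-slice from selected faces.**  For ONE Galois CM field `K` with `6 ≤ [K:ℚ]` and a selection `R` of its faces reaching every
face by a Galois twist followed by a square symmetry: foreign witnesses for the SELECTED faces give the Hodge conjecture for every complex
abelian variety dominated by a product tree of realisations of CM types of CM subfields of `K` (part 1's
`hodgeConjectureFor_of_avDominatedBy_isProductOf_of_exists_foreignFacePeriod_at`). FRAMING: conditional on `K`'s selected face periods.
[cite: Shimura1998, §6.2 Theorem 3 and §6.1 Corollary of Theorem 2 (pp. 41–43)] [cite: Pohlmann1968, Thm. 1]
[cite: Andre1992HodgeCM, Théorème (pp. 4–5)] [cite: MumfordAV1970, §19 Thm. 1 and p. 169] -/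
theorem hodgeConjectureFor_of_avDominatedBy_isProductOf_of_foreignFacePeriod_representatives_at (K : CMField) [hG : IsGalois ℚ K]
    (h6 : 6 ≤ Module.finrank ℚ K) (R : Face K → Prop)
    (hR : ∀ f : Face K, ∃ (f₀ : Face K) (g : (K : Type) ≃+* K), R f₀ ∧
      ((InfinitePlace.mk f.p = InfinitePlace.mk (f₀.twist g).p ∧ InfinitePlace.mk f.p' = InfinitePlace.mk (f₀.twist g).p') ∨
        (InfinitePlace.mk f.p = InfinitePlace.mk (f₀.twist g).p' ∧ InfinitePlace.mk f.p' = InfinitePlace.mk (f₀.twist g).p)) ∧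
      (f.Φ = (f₀.twist g).Φ ∨ f.Φ = flip (f₀.twist g).p (f₀.twist g).Φ ∨ f.Φ = flip (f₀.twist g).p' (f₀.twist g).Φ ∨
        f.Φ = flip (f₀.twist g).p' (flip (f₀.twist g).p (f₀.twist g).Φ)))
    (h : ∀ f : Face K, R f → ∃ (L : CMField) (ι₁ : L →+* ℂ) (V : HermSpace3 L ι₁) (σ : K →+* ℂ),
      (Model.picardCMUniverse exists_isReal_hodgeModel_holds hodgePQ_independent_of_hodgeModel_holds
        BallQuotient.ballQuotientUniformised_holds cmAbelianVarietyRealised_holds).PeriodNV ι₁ V K f.psi σ)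
    {P A : AbelianVariety ℂ} (hP : AbelianVariety.IsProductOf (fun B : AbelianVariety ℂ =>
      ∃ (E : Type) (_ : Field E) (_ : NumberField E) (_ : IsCMField E) (_ : E →+* (K : Type)) (Φ : CMType E)
        (ι : 𝓞 E →+* End B) (θ : E →+* Module.End ℂ (complexBetti B.X 1)),
        IsCMTypeRealisation Φ B ι θ) P)
    (hA : AVDominatedBy A P) : HodgeConjectureFor A.dim A.X := by
  refine hodgeConjectureFor_of_avDominatedBy_isProductOf_of_exists_foreignFacePeriod_at K h6 (fun f => ?_) hP hA
  obtain ⟨f₀, g, hR₀, hpl, hΦ⟩ := hR f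
  obtain ⟨L, ι₁, V, σ, hw⟩ := h f₀ hR₀
  obtain ⟨τ, hτ⟩ := Model.exists_foreignPeriodNV_of_sameSquare_twist _ _ _ _ h6 f₀ g hpl hΦ hw
  exact ⟨L, ι₁, V, τ, hτ⟩

end Summit.HodgeConjecture.CorCM
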